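import Mathlib.Analysis.MellinInversion
import Mathlib.Analysis.Complex.CauchyIntegral
import Mathlib.Analysis.Complex.Asymptotics
import Mathlib.MeasureTheory.Measure.Lebesgue.Integral
import HarnessLib

/-!
# Uniqueness of the Mellin transform

A function on `(0, ∞)` is determined, at each of its points of continuity, by the values of its
Mellin transform `mellin f z = ∫₀^∞ t^{z-1} f(t) dt` (Mathlib) on any subset of the open strip of
absolute convergence that has an accumulation point in the strip — in particular by its values on
a real interval, or on a vertical line.

The proof is the classical one: for `f` locally integrable on `(0, ∞)`, `O(t^{-a})` at `∞` and
`O(t^{-b})` at `0⁺`, Mathlib's `mellin_differentiableAt_of_isBigO_rpow` makes `mellin f`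
holomorphic on the strip `b < re z < a`; the identity theorem
(`AnalyticOnNhd.eqOn_zero_of_preconnected_of_frequently_eq_zero`) propagates vanishing from an
accumulation point to the whole strip, hence to a vertical line `re z = σ`; and on a vertical
line the Mellin transform is a Fourier transform, so Mathlib's Mellin inversion theorem
`mellinInv_mellin_eq` (whose integrability hypothesis on the transform is trivially satisfied by
the zero function) gives `f = 0` at every continuity point.

## Main results

* `differentiableOn_mellin`, `analyticOnNhd_mellin`: holomorphy of `mellin f` on the strip
  `Complex.re ⁻¹' Set.Ioo b a`.
* `mellin_eqOn_zero_of_frequently_eq_zero`: the identity theorem in the strip.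
* `eq_zero_of_mellin_vertical_eq_zero`: vanishing on a vertical line of convergence forces
  `f = 0` at continuity points.
* `eq_zero_of_frequently_mellin_eq_zero`, `eq_zero_of_mellin_eq_zero_on_Ioo`,
  `eq_of_mellin_eq_on_Ioo`: uniqueness from an accumulation point / from a real interval.
* `mellin_ofReal`, `eq_zero_of_integral_rpow_mul_eq_zero`: real-valued forms
  (`∫₀^∞ t^{x-1} f(t) dt = 0` for `x` in an interval).
* `integral_mul_abs_rpow_neg_of_even`, `eq_of_integral_mul_abs_rpow_neg_eq`: the two-sided
  form for continuous even functions on `ℝ`: the moments `∫ f(s) |s|^{-δ} ds`, `δ` in an open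
  subinterval of `(1-β, 1)`, determine an even continuous `f = O(|s|^{-β})`.

## References

Standard (uniqueness theorem for the Mellin / bilateral Laplace transform), see e.g.
D. V. Widder, *The Laplace Transform*, Princeton 1941, Ch. VI (bilateral Laplace transform,
uniqueness), and E. C. Titchmarsh, *Introduction to the theory of Fourier integrals*, 1948,
§1.29 (Mellin inversion).  All statements below are tagged `[folklore]`.

What is NOT here: uniqueness for transforms of measures, and `L¹`-a.e. conclusions without a
continuity point (for the Fourier side of that see
`Literature/Analysis/Fourier/FourierUniquenessL1.lean`).
-/

noncomputable section

open MeasureTheory Set Filter Asymptotics Complex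
open scoped Topology Real

namespace Literature.Analysis.SpecialFunctions

variable {E : Type*} [NormedAddCommGroup E] [NormedSpace ℂ E]

section Strip

variable {a b : ℝ} {f : ℝ → E}

/-- **Holomorphy of the Mellin transform in its strip of absolute convergence.** If `f` is
locally integrable on `(0, ∞)`, `O(t^{-a})` at `∞` and `O(t^{-b})` at `0⁺`, then `mellin f` is
complex differentiable on the open strip `b < re z < a` (pointwise this is Mathlib's
`mellin_differentiableAt_of_isBigO_rpow`). [folklore] -/
theorem differentiableOn_mellin (hfc : LocallyIntegrableOn f (Ioi 0))
    (hf_top : f =O[atTop] (· ^ (-a))) (hf_bot : f =O[𝓝[>] 0] (· ^ (-b))) :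
    DifferentiableOn ℂ (mellin f) (re ⁻¹' Ioo b a) := fun _ hz =>
  (mellin_differentiableAt_of_isBigO_rpow hfc hf_top hz.2 hf_bot hz.1).differentiableWithinAt

/-- The open vertical strip `b < re z < a` is preconnected (it is convex). [folklore] -/
theorem isPreconnected_re_preimage_Ioo (b a : ℝ) : IsPreconnected (re ⁻¹' Ioo b a) :=
  ((convex_Ioo b a).linear_preimage reLm).isPreconnected

variable [CompleteSpace E]

/-- **Analyticity of the Mellin transform in its strip of absolute convergence.** [folklore] -/
theorem analyticOnNhd_mellin (hfc : LocallyIntegrableOn f (Ioi 0))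
    (hf_top : f =O[atTop] (· ^ (-a))) (hf_bot : f =O[𝓝[>] 0] (· ^ (-b))) :
    AnalyticOnNhd ℂ (mellin f) (re ⁻¹' Ioo b a) :=
  (differentiableOn_mellin hfc hf_top hf_bot).analyticOnNhd (isOpen_Ioo.preimage continuous_re)

/-- **Identity theorem for the Mellin transform.** If `mellin f` vanishes frequently near a point
`z₀` of the strip of convergence (i.e. on a set accumulating at `z₀`), it vanishes on the whole
strip. [folklore] -/
theorem mellin_eqOn_zero_of_frequently_eq_zero (hfc : LocallyIntegrableOn f (Ioi 0))
    (hf_top : f =O[atTop] (· ^ (-a))) (hf_bot : f =O[𝓝[>] 0] (· ^ (-b))) {z₀ : ℂ}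
    (hz₀ : z₀ ∈ re ⁻¹' Ioo b a) (hfr : ∃ᶠ z in 𝓝[≠] z₀, mellin f z = 0) :
    EqOn (mellin f) 0 (re ⁻¹' Ioo b a) :=
  (analyticOnNhd_mellin hfc hf_top hf_bot).eqOn_zero_of_preconnected_of_frequently_eq_zero
    (isPreconnected_re_preimage_Ioo b a) hz₀ hfr

end Strip

variable [CompleteSpace E]

/-- **Uniqueness from a vertical line.** If the Mellin integral of `f` converges absolutely at
`σ` and `mellin f` vanishes on the whole line `re z = σ`, then `f x = 0` at every point `x > 0`
of continuity of `f` (Mellin inversion, Mathlib's `mellinInv_mellin_eq`, the vertical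
integrability of the transform being that of the zero function). [folklore] -/
theorem eq_zero_of_mellin_vertical_eq_zero {σ : ℝ} {f : ℝ → E} (hf : MellinConvergent f σ)
    (h : ∀ y : ℝ, mellin f (σ + y * I) = 0) {x : ℝ} (hx : 0 < x) (hfx : ContinuousAt f x) :
    f x = 0 := by
  have hFf : VerticalIntegrable (mellin f) σ := by
    simp only [VerticalIntegrable, h]
    exact integrable_zero _ _ _
  rw [← mellinInv_mellin_eq σ f hx hf hFf hfx, mellinInv]
  simp [h]

/-- **Uniqueness of the Mellin transform (accumulation-point form).** If `f` is locally
integrable on `(0, ∞)`, `O(t^{-a})` at `∞`, `O(t^{-b})` at `0⁺`, and `mellin f` vanishes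
frequently near some `z₀` with `b < re z₀ < a`, then `f x = 0` at every continuity point `x > 0`.
[folklore] -/
theorem eq_zero_of_frequently_mellin_eq_zero {a b : ℝ} {f : ℝ → E}
    (hfc : LocallyIntegrableOn f (Ioi 0)) (hf_top : f =O[atTop] (· ^ (-a)))
    (hf_bot : f =O[𝓝[>] 0] (· ^ (-b))) {z₀ : ℂ} (hz₀ : z₀ ∈ re ⁻¹' Ioo b a)
    (hfr : ∃ᶠ z in 𝓝[≠] z₀, mellin f z = 0) {x : ℝ} (hx : 0 < x) (hfx : ContinuousAt f x) :
    f x = 0 := by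
  have hstrip := mellin_eqOn_zero_of_frequently_eq_zero hfc hf_top hf_bot hz₀ hfr
  have hσ : b < z₀.re ∧ z₀.re < a := hz₀
  refine eq_zero_of_mellin_vertical_eq_zero (σ := z₀.re)
    (mellinConvergent_of_isBigO_rpow hfc hf_top (by simpa using hσ.2) hf_bot
      (by simpa using hσ.1)) (fun y => hstrip ?_) hx hfx
  show ((z₀.re : ℂ) + y * I).re ∈ Ioo b a
  simpa using hσ

/-- **Uniqueness of the Mellin transform (real-interval form).** If `f` is locally integrable on
`(0, ∞)`, `O(t^{-a})` at `∞`, `O(t^{-b})` at `0⁺`, and `mellin f x = 0` for all real `x` in a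
nonempty open interval `(lo, hi) ⊆ (b, a)`, then `f x = 0` at every continuity point `x > 0`.
[folklore] -/
theorem eq_zero_of_mellin_eq_zero_on_Ioo {a b lo hi : ℝ} {f : ℝ → E}
    (hfc : LocallyIntegrableOn f (Ioi 0)) (hf_top : f =O[atTop] (· ^ (-a)))
    (hf_bot : f =O[𝓝[>] 0] (· ^ (-b))) (hlo : b ≤ lo) (hhi : hi ≤ a) (hlh : lo < hi)
    (h : ∀ x : ℝ, lo < x → x < hi → mellin f x = 0) {x : ℝ} (hx : 0 < x)
    (hfx : ContinuousAt f x) : f x = 0 := by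
  obtain ⟨σ, h1, h2⟩ : ∃ σ : ℝ, lo < σ ∧ σ < hi := ⟨(lo + hi) / 2, by linarith, by linarith⟩
  refine eq_zero_of_frequently_mellin_eq_zero hfc hf_top hf_bot (z₀ := (σ : ℂ))
    (show (σ : ℂ).re ∈ Ioo b a by simp only [ofReal_re]; exact ⟨by linarith, by linarith⟩)
    ?_ hx hfx
  have ht : Tendsto (fun x : ℝ => (x : ℂ)) (𝓝[≠] σ) (𝓝[≠] (σ : ℂ)) :=
    continuous_ofReal.continuousWithinAt.tendsto_nhdsWithin fun x hx => by
      simpa using hx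
  have hev : ∀ᶠ x : ℝ in 𝓝[≠] σ, mellin f (x : ℂ) = 0 := by
    filter_upwards [mem_nhdsWithin_of_mem_nhds (Ioo_mem_nhds h1 h2)] with x hx
    exact h x hx.1 hx.2
  exact ht.frequently hev.frequently

/-- **Two functions with the same Mellin transform on a real interval agree** at every common
continuity point of `(0, ∞)` (same hypotheses as `eq_zero_of_mellin_eq_zero_on_Ioo` for both).
[folklore] -/
theorem eq_of_mellin_eq_on_Ioo {a b lo hi : ℝ} {f g : ℝ → E}
    (hfc : LocallyIntegrableOn f (Ioi 0)) (hgc : LocallyIntegrableOn g (Ioi 0))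
    (hf_top : f =O[atTop] (· ^ (-a))) (hg_top : g =O[atTop] (· ^ (-a)))
    (hf_bot : f =O[𝓝[>] 0] (· ^ (-b))) (hg_bot : g =O[𝓝[>] 0] (· ^ (-b)))
    (hlo : b ≤ lo) (hhi : hi ≤ a) (hlh : lo < hi)
    (h : ∀ x : ℝ, lo < x → x < hi → mellin f x = mellin g x) {x : ℝ} (hx : 0 < x)
    (hfx : ContinuousAt f x) (hgx : ContinuousAt g x) : f x = g x := by
  refine sub_eq_zero.1 (eq_zero_of_mellin_eq_zero_on_Ioo (f := fun t => f t - g t)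
    (hfc.sub hgc) (hf_top.sub hg_top) (hf_bot.sub hg_bot) hlo hhi hlh ?_ hx (hfx.sub hgx))
  intro x h1x h2x
  have hfm : MellinConvergent f x :=
    mellinConvergent_of_isBigO_rpow hfc hf_top (by simp only [ofReal_re]; linarith) hf_bot
      (by simp only [ofReal_re]; linarith)
  have hgm : MellinConvergent g x :=
    mellinConvergent_of_isBigO_rpow hgc hg_top (by simp only [ofReal_re]; linarith) hg_bot
      (by simp only [ofReal_re]; linarith)
  rw [(hasMellin_sub hfm hgm).2, h x h1x h2x, sub_self]

/-! ### Real-valued functions -/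

/-- For real-valued `f` and real `x`, the Mellin transform of `f` (coerced to `ℂ`) at `x` is
the real integral `∫₀^∞ t^{x-1} f(t) dt`. [folklore] -/
theorem mellin_ofReal (f : ℝ → ℝ) (x : ℝ) :
    mellin (fun t => (f t : ℂ)) x = ((∫ t in Ioi (0:ℝ), t ^ (x - 1) * f t : ℝ) : ℂ) := by
  rw [mellin, ← integral_complex_ofReal]
  refine setIntegral_congr_fun measurableSet_Ioi fun t (ht : 0 < t) => ?_
  simp only [smul_eq_mul]
  rw [ofReal_mul, ofReal_cpow ht.le, ofReal_sub, ofReal_one]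

/-- `t ↦ (f t : ℂ)` is locally integrable where `f` is. [folklore] -/
theorem locallyIntegrableOn_ofReal {f : ℝ → ℝ} {s : Set ℝ} (hfc : LocallyIntegrableOn f s) :
    LocallyIntegrableOn (fun t => (f t : ℂ)) s := by
  intro t ht
  obtain ⟨u, hu, hint⟩ := hfc t ht
  exact ⟨u, hu, hint.integrable.ofReal⟩

/-- **Uniqueness of the real Mellin transform.** If `f : ℝ → ℝ` is locally integrable on
`(0, ∞)`, `O(t^{-a})` at `∞`, `O(t^{-b})` at `0⁺`, and `∫₀^∞ t^{x-1} f(t) dt = 0` for all `x`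
in a nonempty open interval `(lo, hi) ⊆ (b, a)`, then `f x = 0` at every continuity point
`x > 0`. [folklore] -/
theorem eq_zero_of_integral_rpow_mul_eq_zero {a b lo hi : ℝ} {f : ℝ → ℝ}
    (hfc : LocallyIntegrableOn f (Ioi 0)) (hf_top : f =O[atTop] (· ^ (-a)))
    (hf_bot : f =O[𝓝[>] 0] (· ^ (-b))) (hlo : b ≤ lo) (hhi : hi ≤ a) (hlh : lo < hi)
    (h : ∀ x : ℝ, lo < x → x < hi → ∫ t in Ioi (0:ℝ), t ^ (x - 1) * f t = 0) {x : ℝ}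
    (hx : 0 < x) (hfx : ContinuousAt f x) : f x = 0 := by
  have key := eq_zero_of_mellin_eq_zero_on_Ioo (f := fun t => (f t : ℂ))
    (locallyIntegrableOn_ofReal hfc) (isBigO_ofReal_left.2 hf_top) (isBigO_ofReal_left.2 hf_bot)
    hlo hhi hlh (fun x h1 h2 => by rw [mellin_ofReal, h x h1 h2, ofReal_zero]) hx
    (continuous_ofReal.continuousAt.comp hfx)
  exact_mod_cast key

/-! ### Even functions on the line: the moments `∫ f(s) |s|^{-δ} ds` -/

/-- For an even function, `∫_ℝ u(s) |s|^{-δ} ds = 2 ∫₀^∞ s^{-δ} u(s) ds` (no integrability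
needed: both sides vanish together otherwise). [folklore] -/
theorem integral_mul_abs_rpow_neg_of_even {u : ℝ → ℝ} (hu : ∀ s, u (-s) = u s) (δ : ℝ) :
    ∫ s, u s * |s| ^ (-δ) = 2 * ∫ s in Ioi (0:ℝ), s ^ (-δ) * u s := by
  have : (fun s => u s * |s| ^ (-δ)) = fun s => (fun t => t ^ (-δ) * u t) |s| := by
    ext s
    show u s * |s| ^ (-δ) = |s| ^ (-δ) * u |s|
    rcases le_or_gt 0 s with hs | hs
    · rw [abs_of_nonneg hs, mul_comm]
    · rw [abs_of_neg hs, hu, mul_comm]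
  rw [this]
  exact integral_comp_abs (f := fun t => t ^ (-δ) * u t)

/-- A function continuous at `0` is `O(t ^ (-0))` at `0⁺` (the form of the hypothesis at `0` in
Mathlib's Mellin library). [folklore] -/
theorem isBigO_rpow_neg_zero_of_continuousAt {u : ℝ → ℝ} (hu : ContinuousAt u 0) :
    u =O[𝓝[>] 0] (· ^ (-(0:ℝ))) := by
  simp only [neg_zero, Real.rpow_zero]
  exact (hu.tendsto.isBigO_one ℝ).mono nhdsWithin_le_nhds

/-- **Even continuous functions are determined by their `|s|^{-δ}`-moments on an interval of
exponents.** Let `f, g : ℝ → ℝ` be continuous, even, `O(s^{-β})` at `+∞`, and suppose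
`∫ f(s)|s|^{-δ} ds = ∫ g(s)|s|^{-δ} ds` for all `δ` in a nonempty open interval `(lo, hi)` with
`1 - β ≤ lo` and `hi ≤ 1` (so that all these integrals converge absolutely on `(0, ∞)`; by
evenness `∫_ℝ = 2 ∫₀^∞` unconditionally, `integral_mul_abs_rpow_neg_of_even`).  Then `f = g`.
(Substituting `x = 1 - δ`, the hypothesis says that the real Mellin transforms of `f|_{(0,∞)}`
and `g|_{(0,∞)}` agree on `(1 - hi, 1 - lo) ⊆ (0, β)`.) [folklore] -/
theorem eq_of_integral_mul_abs_rpow_neg_eq {β lo hi : ℝ} {f g : ℝ → ℝ}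
    (hf : Continuous f) (hg : Continuous g) (hfe : ∀ s, f (-s) = f s) (hge : ∀ s, g (-s) = g s)
    (hfO : f =O[atTop] (· ^ (-β))) (hgO : g =O[atTop] (· ^ (-β)))
    (hβ : 1 - β ≤ lo) (hhi : hi ≤ 1) (hlh : lo < hi)
    (h : ∀ δ : ℝ, lo < δ → δ < hi → ∫ s, f s * |s| ^ (-δ) = ∫ s, g s * |s| ^ (-δ)) :
    f = g := by
  -- the difference `u`
  set u : ℝ → ℝ := fun s => f s - g s with hu_def
  have hu : Continuous u := hf.sub hg
  have hue : ∀ s, u (-s) = u s := fun s => by simp [hu_def, hfe, hge]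
  have hfc : LocallyIntegrableOn f (Ioi 0) := hf.locallyIntegrable.locallyIntegrableOn _
  have hgc : LocallyIntegrableOn g (Ioi 0) := hg.locallyIntegrable.locallyIntegrableOn _
  have hfb := isBigO_rpow_neg_zero_of_continuousAt hf.continuousAt
  have hgb := isBigO_rpow_neg_zero_of_continuousAt hg.continuousAt
  -- real Mellin transforms of `u` vanish on `(1 - hi, 1 - lo)`
  have hmom : ∀ x : ℝ, 1 - hi < x → x < 1 - lo → ∫ t in Ioi (0:ℝ), t ^ (x - 1) * u t = 0 := by
    intro x h1 h2
    have hfi : IntegrableOn (fun t : ℝ => t ^ (x - 1) * f t) (Ioi 0) :=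
      mellin_convergent_of_isBigO_scalar hfc hfO (by linarith) hfb (by linarith)
    have hgi : IntegrableOn (fun t : ℝ => t ^ (x - 1) * g t) (Ioi 0) :=
      mellin_convergent_of_isBigO_scalar hgc hgO (by linarith) hgb (by linarith)
    have key := h (1 - x) (by linarith) (by linarith)
    rw [integral_mul_abs_rpow_neg_of_even hfe, integral_mul_abs_rpow_neg_of_even hge,
      show -(1 - x) = x - 1 by ring] at key
    have : (fun t : ℝ => t ^ (x - 1) * u t) = fun t => t ^ (x - 1) * f t - t ^ (x - 1) * g t := by
      ext t; simp only [hu_def]; ring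
    rw [this, integral_sub hfi hgi]
    linarith
  -- hence `u = 0` on `(0, ∞)`, then on `[0, ∞)` by continuity, then everywhere by evenness
  have hpos : EqOn u 0 (Ioi 0) := fun x hx =>
    eq_zero_of_integral_rpow_mul_eq_zero (a := β) (b := 0) (lo := 1 - hi) (hi := 1 - lo)
      (hu.locallyIntegrable.locallyIntegrableOn _) (hfO.sub hgO)
      (isBigO_rpow_neg_zero_of_continuousAt hu.continuousAt) (by linarith) (by linarith)
      (by linarith) hmom hx hu.continuousAt
  have hnn : EqOn u 0 (Ici 0) := by
    simpa only [closure_Ioi] using hpos.closure hu continuous_const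
  funext s
  refine sub_eq_zero.1 (show u s = 0 from ?_)
  rcases le_or_gt 0 s with hs | hs
  · exact hnn hs
  · rw [← hue]; exact hnn (show (0:ℝ) ≤ -s by linarith)

end Literature.Analysis.SpecialFunctions
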